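import Mathlib
import Summits.ValiantsHypothesis.ValiantsHypothesis.Theorems.ValuativeGCTValuativeFlipFourRowHilbertTools

/-!
# Four-row Hilbert-function lower bound (stub `stub_fourRowHilbertLowerBound` of line `four-row-count`, part 2 of 2)

Crux `ValuativeGCT.ValuativeFlip` (stmt-ValiantsHypothesis-12624), line
`Cruxes/ValuativeFlip/Lines/four_row_count.lean`, registered stub `stub_fourRowHilbertLowerBound`
(per side of the four-row census `headCensus_of`; the four-row analogue of the landed B3
`stub_hilbertLowerBound`, `Theorems/ValuativeGCTValuativeFlipHilbertLowerBound.lean`, with the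
base point moved from `A = 1` to `A = g` and the coefficient functionals restricted to exponents
supported on the kept variables).

Statement.  For a set `K` of kept variables (a predicate `κ`; in the stub, the last four row
slots of `MatIdx m`) write `ρ` for the restriction `x_i ↦ x_i` (`i ∈ K`), `x_i ↦ 0` (`i ∉ K`), and
`D_K ⊂ DegIdx σ m` for the degree-`m` exponents supported on `K`.  If the restricted tangent span
`span{x_a · ρ(∂_b (g · f)) : a ∈ K, b ∈ σ}` of `g · f` has dimension `≥ N + 1`, then the
degree-`δ` piece of the `K`-ROW orbit image `genericOrbitMap f m (ℂ[X_d : d ∈ D_K]_δ)` — the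
degree-`δ` coordinate ring of the closure of `{(A · f)|_K : A ∈ End}` — has dimension `≥ C(δ + N, N)`.

Method: move the base point to `1` (`frh_finrank_map_linSubst`, part 1), then initial forms at
`A = 1` as in B3 with `D_K`-supported coefficient vectors (`frh_core`): the `D_K`-rows of the
tangent matrix have rank `≥ N + 1` (`frh_rowRank`), the constant-term functional has a kernel of
codimension `≤ 1` there, and `frh_count` finishes; when `ρ h = 0` all `N + 1` initial forms are
linear (second case).  [Mulmuley–Sohoni 2001 §4; BLMW 2011 §5.2; folklore]
-/

-- `Summit.ValiantsHypothesis.ValiantsHypothesis.…` is the tree's mandated single-conjunct layout (Sub = Summit).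
set_option linter.dupNamespace false

namespace Summit.ValiantsHypothesis.ValiantsHypothesis.Theorems.ValuativeFlip

open MvPolynomial
open scoped BigOperators Matrix
open Literature.NumberTheory.DiophantineGeometry
open Literature.Computability.AlgebraicComplexity

noncomputable section

/-- `hlbτ⟦σ⟧`: the translation `A ↦ 1 + A` on `ℂ[Mat_σ]` (as in B3). -/
local notation3 "hlbτ⟦" s "⟧" =>
  (MvPolynomial.aeval (R := ℂ) fun p : s × s => X p + C (if p.1 = p.2 then (1 : ℂ) else 0))

/-- `hlbM⟦σ, f, m⟧`: the tangent matrix `M[d, (a,b)] = coeff_d (x_a ∂_b f)` (as in B3). -/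
local notation3 "hlbM⟦" s ", " f ", " m "⟧" =>
  (Matrix.of fun (d : DegIdx s m) (p : s × s) => coeff d.1 (X p.1 * pderiv p.2 f))

section Core

variable {σ : Type*} [Fintype σ] [LinearOrder σ]

/-- **`K`-row Hilbert-function lower bound at the base point `A = 1`.**  If
`span{x_a · ρ(∂_b h) : a ∈ K, b}` has dimension `≥ N + 1`, the degree-`δ` piece of
`genericOrbitMap h m (ℂ[X_d : d ∈ D_K])` has dimension `≥ C(δ + N, N)`. [folklore] -/
theorem frh_core (κ : σ → Prop) [DecidablePred κ] {h : MvPolynomial σ ℂ} {m : ℕ}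
    (hh : h.IsHomogeneous m) (N δ : ℕ)
    (hN : N + 1 ≤ Module.finrank ℂ ↥(Submodule.span ℂ (Set.range fun ab : {a // κ a} × σ =>
        (X ab.1.1 : MvPolynomial σ ℂ) *
          aeval (fun i => if κ i then (X i : MvPolynomial σ ℂ) else 0) (pderiv ab.2 h)))) :
    Nat.choose (δ + N) N ≤ Module.finrank ℂ ↥((MvPolynomial.homogeneousSubmodule (DegIdx σ m) ℂ δ ⊓
        Subalgebra.toSubmodule (MvPolynomial.supported ℂ
          {d : DegIdx σ m | ∀ i, ¬ κ i → d.1 i = 0})).map (genericOrbitMap h m).toLinearMap) := by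
  classical
  -- the predicate of `K`-supported exponents, the tangent matrix, the `K`-supported vectors
  set P : DegIdx σ m → Prop := fun d => ∀ i, ¬ κ i → d.1 i = 0 with hPdef
  set Λ₀ : (DegIdx σ m → ℂ) →ₗ[ℂ] (σ × σ → ℂ) := (hlbM⟦σ, h, m⟧).vecMulLinear with hΛ₀
  let VK : Submodule ℂ (DegIdx σ m → ℂ) :=
    { carrier := {a | ∀ d, ¬ P d → a d = 0}
      add_mem' := fun {a b} ha hb d hd => by
        simp only [Pi.add_apply, ha d hd, hb d hd, add_zero]
      zero_mem' := fun d _ => rfl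
      smul_mem' := fun c a ha d hd => by
        simp only [Pi.smul_apply, ha d hd, smul_zero] }
  have hVK : ∀ a, a ∈ VK ↔ ∀ d, ¬ P d → a d = 0 := fun a => Iff.rfl
  have hsingle : ∀ d₀, P d₀ → (Pi.single d₀ (1 : ℂ) : DegIdx σ m → ℂ) ∈ VK := fun d₀ hd₀ d hd => by
    have hne : d ≠ d₀ := fun h => hd (h ▸ hd₀)
    rw [Pi.single_apply, if_neg hne]
  -- Step 0: the `K`-rows of the tangent matrix span a space of dimension `≥ N + 1`
  have hrows : N + 1 ≤ Module.finrank ℂ ↥(VK.map Λ₀) := by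
    have h1 := hN.trans (frh_rowRank κ hh (m := m))
    have h2 : Submodule.span ℂ (Set.range ((hlbM⟦σ, h, m⟧).submatrix
        (Subtype.val : {d : DegIdx σ m // ∀ i, ¬ κ i → d.1 i = 0} → DegIdx σ m) id).row) ≤
        VK.map Λ₀ := by
      refine Submodule.span_le.mpr ?_
      rintro _ ⟨x, rfl⟩
      refine ⟨Pi.single x.1 1, hsingle x.1 x.2, ?_⟩
      rw [hΛ₀, Matrix.vecMulLinear_apply, Matrix.single_one_vecMul]
      rfl
    exact h1.trans (Submodule.finrank_mono h2)
  -- the constant-term functional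
  set kap : (DegIdx σ m → ℂ) →ₗ[ℂ] ℂ := Fintype.linearCombination ℂ (fun d => coeff d.1 h) with hkap
  have hkap_apply : ∀ a, kap a = ∑ d, a d * coeff d.1 h := fun a => by
    simp only [hkap, Fintype.linearCombination_apply, smul_eq_mul]
  set lin : (DegIdx σ m → ℂ) → MvPolynomial (DegIdx σ m) ℂ :=
    fun c => ∑ d, c d • (X d : MvPolynomial (DegIdx σ m) ℂ) with hlin
  by_cases hcase : ∃ d₀ : DegIdx σ m, P d₀ ∧ coeff d₀.1 h ≠ 0
  · -- Case (i): some `K`-supported coefficient of `h` is nonzero (B3's argument)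
    obtain ⟨d₀, hPd₀, hκ₀⟩ := hcase
    set κ₀ : ℂ := coeff d₀.1 h
    set K : Submodule ℂ (DegIdx σ m → ℂ) := LinearMap.ker kap ⊓ VK with hK
    set e₀ : DegIdx σ m → ℂ := Pi.single d₀ 1 with he₀
    have he₀V : e₀ ∈ VK := hsingle d₀ hPd₀
    have hkap_e₀ : kap e₀ = κ₀ := by
      rw [he₀, hkap, Fintype.linearCombination_apply_single, one_smul]
    -- Step 1: the rows `Λ₀ a`, `a ∈ K`, span a space of dimension `≥ N`
    have hle : VK.map Λ₀ ≤ K.map Λ₀ ⊔ ℂ ∙ (Λ₀ e₀) := by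
      rintro _ ⟨a, ha, rfl⟩
      rw [show a = (a - (kap a / κ₀) • e₀) + (kap a / κ₀) • e₀ by rw [sub_add_cancel], map_add,
        LinearMap.map_smul]
      refine Submodule.add_mem_sup (Submodule.mem_map_of_mem ?_)
        (Submodule.smul_mem _ _ (Submodule.mem_span_singleton_self _))
      rw [hK]
      refine ⟨?_, VK.sub_mem ha (VK.smul_mem _ he₀V)⟩
      rw [SetLike.mem_coe, LinearMap.mem_ker, map_sub, LinearMap.map_smul, hkap_e₀, smul_eq_mul,
        div_mul_cancel₀ _ hκ₀, sub_self]
    have hKN : N ≤ Module.finrank ℂ (K.map Λ₀) := by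
      have h1 := Submodule.finrank_mono hle
      have h2 := Submodule.finrank_add_le_finrank_add_finrank (K.map Λ₀) (ℂ ∙ (Λ₀ e₀))
      have h3 : Module.finrank ℂ (ℂ ∙ (Λ₀ e₀)) ≤ 1 :=
        (finrank_span_le_card ({Λ₀ e₀} : Set (σ × σ → ℂ))).trans (by simp)
      omega
    -- Step 2: `N` such vectors `a k` with linearly independent rows `A k = Λ₀ (a k)`
    obtain ⟨b, hb⟩ := exists_linearIndependent_of_le_finrank hKN
    have hbmem : ∀ k, ∃ a ∈ K, Λ₀ a = (b k : σ × σ → ℂ) := fun k => Submodule.mem_map.mp (b k).2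
    choose a haK haΛ using hbmem
    set A : Matrix (Fin N) (σ × σ) ℂ := Matrix.of fun k => (b k : σ × σ → ℂ)
    have hinj := hlb_aeval_injective_of_linearIndependent A
      (hb.map' (K.map Λ₀).subtype (Submodule.ker_subtype _))
    set L : Fin N → MvPolynomial (σ × σ) ℂ := fun k => ∑ p, A k p • X p
    -- Step 3: the `N + 1` translated functionals, their degrees and lowest forms
    set avec : Fin (N + 1) → (DegIdx σ m → ℂ) :=
      (Fin.cons (κ₀⁻¹ • e₀) a : Fin (N + 1) → DegIdx σ m → ℂ) with havec
    have havecV : ∀ k d, ¬ P d → avec k d = 0 := fun k => by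
      rcases Fin.eq_zero_or_eq_succ k with rfl | ⟨k, rfl⟩
      · rw [havec, Fin.cons_zero]
        exact (hVK _).mp (VK.smul_mem _ he₀V)
      · rw [havec, Fin.cons_succ]
        exact (hVK _).mp (by have := haK k; rw [hK] at this; exact this.2)
    set pdeg : Fin (N + 1) → ℕ := (Fin.cons 0 (fun _ => 1) : Fin (N + 1) → ℕ) with hpdeg
    set lead : Fin (N + 1) → MvPolynomial (σ × σ) ℂ :=
      (Fin.cons 1 L : Fin (N + 1) → MvPolynomial (σ × σ) ℂ) with hlead
    have hwk : ∀ k, (∀ j < pdeg k, homogeneousComponent j (hlbτ⟦σ⟧ (genericOrbitMap h m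
        (lin (avec k)))) = 0) ∧
        homogeneousComponent (pdeg k) (hlbτ⟦σ⟧ (genericOrbitMap h m (lin (avec k)))) = lead k := by
      intro k
      have h01 : homogeneousComponent 0 (hlbτ⟦σ⟧ (genericOrbitMap h m (lin (avec k)))) =
          C (kap (avec k)) ∧ homogeneousComponent 1 (hlbτ⟦σ⟧ (genericOrbitMap h m (lin (avec k)))) =
          ∑ p : σ × σ, Λ₀ (avec k) p • (X p : MvPolynomial (σ × σ) ℂ) := by
        rw [hkap_apply, hΛ₀, Matrix.vecMulLinear_apply]
        exact hlb_hc_lin h m (avec k)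
      rcases Fin.eq_zero_or_eq_succ k with rfl | ⟨k, rfl⟩
      · rw [havec, Fin.cons_zero, LinearMap.map_smul, hkap_e₀, smul_eq_mul, inv_mul_cancel₀ hκ₀,
          C_1] at h01
        rw [hpdeg, Fin.cons_zero, hlead, Fin.cons_zero]
        exact ⟨fun j hj => absurd hj (Nat.not_lt_zero _), h01.1⟩
      · have hka : kap (a k) = 0 := by
          have := haK k
          rw [hK] at this
          exact LinearMap.mem_ker.mp this.1
        rw [havec, Fin.cons_succ, hka, C_0, haΛ k] at h01
        rw [hpdeg, Fin.cons_succ, hlead, Fin.cons_succ]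
        exact ⟨fun j hj => by rw [Nat.lt_one_iff.mp hj]; exact h01.1, h01.2⟩
    -- Step 4: the degree-`δ` monomials in the lowest forms `1, L 0, …, L (N-1)` are independent
    have hLI : LinearIndependent ℂ fun e : DegIdx (Fin (N + 1)) δ => ∏ k, lead k ^ e.1 k := by
      have hprod : ∀ e : DegIdx (Fin (N + 1)) δ,
          ∏ k, lead k ^ e.1 k = aeval L (monomial (Finsupp.tail e.1) (1 : ℂ)) := fun e => by
        rw [Fin.prod_univ_succ, hlead, Fin.cons_zero, one_pow, one_mul, aeval_monomial, map_one,
          one_mul, Finsupp.prod_fintype _ _ (fun i => pow_zero _)]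
        simp only [Fin.cons_succ, Finsupp.tail_apply]
      have htail : Function.Injective (fun e : DegIdx (Fin (N + 1)) δ => Finsupp.tail e.1) := by
        intro e e' h
        have hdeg (u : DegIdx (Fin (N + 1)) δ) : u.1 0 + ∑ k, Finsupp.tail u.1 k = δ := by
          simpa only [Finsupp.degree_eq_sum, Fin.sum_univ_succ, Finsupp.tail_apply] using
            mem_degMonomials_iff.mp u.2
        have ht : Finsupp.tail e.1 = Finsupp.tail e'.1 := h
        have h1 := hdeg e
        have h2 := hdeg e'
        rw [ht] at h1
        apply Subtype.ext
        rw [← Finsupp.cons_tail e.1, ← Finsupp.cons_tail e'.1, ht, show e.1 0 = e'.1 0 by omega]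
      have hbm := (basisMonomials (Fin N) ℂ).linearIndependent
      rw [coe_basisMonomials] at hbm
      simp_rw [hprod]
      exact (hbm.comp _ htail).map' (aeval L).toLinearMap (LinearMap.ker_eq_bot.mpr hinj)
    exact frh_count h m P N δ avec havecV pdeg lead hwk hLI
  · -- Case (ii): `ρ h = 0` — all `N + 1` initial forms are linear
    push Not at hcase
    obtain ⟨b, hb⟩ := exists_linearIndependent_of_le_finrank hrows
    have hbmem : ∀ k, ∃ a ∈ VK, Λ₀ a = (b k : σ × σ → ℂ) := fun k => Submodule.mem_map.mp (b k).2
    choose a haV haΛ using hbmem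
    set A : Matrix (Fin (N + 1)) (σ × σ) ℂ := Matrix.of fun k => (b k : σ × σ → ℂ)
    have hinj := hlb_aeval_injective_of_linearIndependent A
      (hb.map' (VK.map Λ₀).subtype (Submodule.ker_subtype _))
    set L : Fin (N + 1) → MvPolynomial (σ × σ) ℂ := fun k => ∑ p, A k p • X p with hL
    have hwk : ∀ k, (∀ j < (fun _ => 1 : Fin (N + 1) → ℕ) k, homogeneousComponent j
        (hlbτ⟦σ⟧ (genericOrbitMap h m (lin (a k)))) = 0) ∧
        homogeneousComponent ((fun _ => 1 : Fin (N + 1) → ℕ) k)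
          (hlbτ⟦σ⟧ (genericOrbitMap h m (lin (a k)))) = L k := by
      intro k
      have h01 : homogeneousComponent 0 (hlbτ⟦σ⟧ (genericOrbitMap h m (lin (a k)))) =
          C (kap (a k)) ∧ homogeneousComponent 1 (hlbτ⟦σ⟧ (genericOrbitMap h m (lin (a k)))) =
          ∑ p : σ × σ, Λ₀ (a k) p • (X p : MvPolynomial (σ × σ) ℂ) := by
        rw [hkap_apply, hΛ₀, Matrix.vecMulLinear_apply]
        exact hlb_hc_lin h m (a k)
      have hka : kap (a k) = 0 := by
        rw [hkap_apply]
        refine Finset.sum_eq_zero fun d _ => ?_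
        by_cases hd : P d
        · rw [hcase d hd, mul_zero]
        · rw [(hVK _).mp (haV k) d hd, zero_mul]
      rw [hka, C_0, haΛ k] at h01
      exact ⟨fun j hj => by rw [Nat.lt_one_iff.mp hj]; exact h01.1, h01.2⟩
    have hLI : LinearIndependent ℂ fun e : DegIdx (Fin (N + 1)) δ => ∏ k, L k ^ e.1 k := by
      have hprod : ∀ e : DegIdx (Fin (N + 1)) δ,
          ∏ k, L k ^ e.1 k = aeval L (monomial e.1 (1 : ℂ)) := fun e => by
        rw [aeval_monomial, map_one, one_mul, Finsupp.prod_fintype _ _ (fun i => pow_zero _)]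
      have hbm := (basisMonomials (Fin (N + 1)) ℂ).linearIndependent
      rw [coe_basisMonomials] at hbm
      simp_rw [hprod]
      exact (hbm.comp (fun e : DegIdx (Fin (N + 1)) δ => e.1) Subtype.val_injective).map'
        (aeval L).toLinearMap (LinearMap.ker_eq_bot.mpr hinj)
    exact frh_count h m P N δ a (fun k => (hVK _).mp (haV k)) (fun _ => 1) L hwk hLI

end Core

/-! ### The registered stub -/

/-- **stub_fourRowHilbertLowerBound** (per side of the four-row census, line `four-row-count`;
four-row analogue of the landed B3 `stub_hilbertLowerBound`, base point moved from `A = 1` to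
`A = g`).  If the four-row tangent span of `g · X₀₀^{m-n} per_n` — the span of
`X_a · (∂_b (g·pp))|_{four kept variables}`, `a` kept, `b` arbitrary — has dimension `≥ N + 1`,
then the degree-`δ` piece of the FOUR-ROW orbit image
`genericOrbitMap pp m (polynomials in the coefficients X_d with d supported on the four kept
variables)` has dimension `≥ C(δ+N, N)`.  Proof: `genericOrbitMap (g·pp) = (Y ↦ Y·g) ∘ genericOrbitMap pp`
(`frh_finrank_map_linSubst`), then initial forms at `Y = 1` with four-row-supported coefficient
functionals (`frh_core`).  [Mulmuley–Sohoni 2001 §4; BLMW 2011 §5.2;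
Theorems/ValuativeGCTValuativeFlipHilbertLowerBound.lean (B3); folklore] -/
theorem stub_fourRowHilbertLowerBound :
    ∀ (n m : ℕ) [NeZero m], n ≤ m → ∀ (g : GL (MatIdx m) ℂ) (N δ : ℕ),
      N + 1 ≤ Module.finrank ℂ ↥(Submodule.span ℂ (Set.range fun ab : {a : MatIdx m // m * m ≤ (((matIdxEquiv m).symm a : Fin (m * m)) : ℕ) + 4} × MatIdx m => (MvPolynomial.X ab.1.1 : MvPolynomial (MatIdx m) ℂ) * MvPolynomial.aeval (fun i : MatIdx m => if m * m ≤ (((matIdxEquiv m).symm i : Fin (m * m)) : ℕ) + 4 then (MvPolynomial.X i : MvPolynomial (MatIdx m) ℂ) else 0) (MvPolynomial.pderiv ab.2 (linSubst (MatIdx m) ℂ ((g : GL (MatIdx m) ℂ) : Matrix (MatIdx m) (MatIdx m) ℂ) (paddedPerFormLex ℂ n m))))) →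
      Nat.choose (δ + N) N ≤ Module.finrank ℂ ↥(((MvPolynomial.homogeneousSubmodule (DegIdx (MatIdx m) m) ℂ δ ⊓ Subalgebra.toSubmodule (MvPolynomial.supported ℂ {d : DegIdx (MatIdx m) m | ∀ i : MatIdx m, ¬ (m * m ≤ (((matIdxEquiv m).symm i : Fin (m * m)) : ℕ) + 4) → d.1 i = 0})).map (genericOrbitMap (paddedPerFormLex ℂ n m) m).toLinearMap)) := by
  intro n m _ hnm g N δ hN
  rw [← frh_finrank_map_linSubst (paddedPerFormLex ℂ n m) m g]
  exact frh_core (fun i : MatIdx m => m * m ≤ (((matIdxEquiv m).symm i : Fin (m * m)) : ℕ) + 4)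
    (linSubst_isHomogeneous _ (paddedPerFormLex_isHomogeneous ℂ hnm)) N δ hN

end

end Summit.ValiantsHypothesis.ValiantsHypothesis.Theorems.ValuativeFlip
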